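import Summits.KontsevichZagierPeriods.KontsevichZagierPeriods.Theorems.HurwitzMicroSectorsNormalFormPrincipleLevelKExistsReps
import Summits.KontsevichZagierPeriods.KontsevichZagierPeriods.Theorems.HurwitzMicroSectorsNormalFormPrincipleDimOneAlgSlabs

/-!
# `NormalFormPrinciple` (stmt-KontsevichZagierPeriods-3869), line `SketchIdeator1` — leaf `stub_boxRigidity`:
# the dimension-one end of the off-resonance chains with an ALGEBRAIC coefficient is a `K`-rational slab

Pure proof file (`--supports` the crux). The level-`K` pipeline for the boxes
`[(0,1)², c x^a y^b/(1 − x^K y^K)]`, `b < a`, ends at the dimension-one representation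
`N₁ = [(0,1), (c/(a−b)) (u^b − u^a)/(1 − u^K)]`. For `c ∈ ℚ` this is of KZ's rational shape
(`levelK_dimOne_isRational`). For `c` real ALGEBRAIC (`c ∈ K = ℚ̄ ∩ ℝ = algebraicClosure ℚ ℝ`) it is
instead a `K`-rational slab `[(0,1), P/Q]` with `P, Q ∈ K[X]` and `Q` WITHOUT ZEROS ON THE CLOSED
INTERVAL `[0,1]` — a generator of the algebraic-slab layer of `Dlog.nfD_of_algSlab` /
`Dlog.nfD_of_mem_closure_algSlab`. The displayed denominator `1 − u^K` vanishes at `u = 1`, so the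
common factor `1 − u` is cancelled first: for `0 < u < 1`,
`(u^b − u^a)/(1 − u^K) = u^b (1 − u^{a−b})/(1 − u^K) = u^b (Σ_{i<a−b} u^i)/(Σ_{j<K} u^j)`,
and `Σ_{j<K} u^j ≥ 1` on `[0,1]` because `K ≥ 1`. Hence
`P = C(c/(a−b)) · X^b · Σ_{i<a−b} X^i`, `Q = Σ_{j<K} X^j` (coefficients in `ℚ(c) ⊂ K`).

References: M. Kontsevich, D. Zagier, *Periods* (2001), §1.1 (algebraic coefficients), §1.2.
No new definitions.
-/

noncomputable section

open MeasureTheory Set Finset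
open scoped Polynomial
open Literature.NumberTheory.Transcendental Literature.NumberTheory.Transcendental.KZ
open Literature.ModelTheory.ExponentialFields (IsSemialgebraic)

namespace Summit.KontsevichZagierPeriods.HurwitzMicroSectors.NormalFormPrinciple.PiBox.LevelK

/-- Evaluation of the geometric-sum polynomial `Σ_{j<n} X^j ∈ K[X]` (`K = algebraicClosure ℚ ℝ`)
at a real point `t` is the real geometric sum `Σ_{j<n} t^j`. [folklore] -/
theorem lka_aeval_geom_sum (n : ℕ) (t : ℝ) :
    (Polynomial.aeval t (∑ j ∈ range n, (Polynomial.X : (algebraicClosure ℚ ℝ)[X]) ^ j) : ℝ) =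
      ∑ j ∈ range n, t ^ j := by
  rw [map_sum]
  refine Finset.sum_congr rfl fun j _ => ?_
  rw [map_pow, Polynomial.aeval_X]

/-- The real geometric sum `Σ_{j<n} t^j` with `n ≥ 1` is positive (indeed `≥ 1`) for `t ≥ 0`.
[folklore] -/
theorem lka_geom_sum_pos {n : ℕ} (hn : 0 < n) {t : ℝ} (ht : 0 ≤ t) :
    0 < ∑ j ∈ range n, t ^ j :=
  geom_sum_pos ht hn.ne'

/-- The cancellation of the common factor `1 − u` behind the slab shape: for a real `u` with
`1 − u^K ≠ 0` and `Σ_{j<K} u^j ≠ 0`, and `b ≤ a`,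
`c' (u^b − u^a)/(1 − u^K) = (c' u^b Σ_{i<a−b} u^i)/(Σ_{j<K} u^j)`
(`1 − u^n = (Σ_{i<n} u^i)(1 − u)`, `u^a = u^b u^{a−b}`). [folklore] -/
theorem lka_cancel (K a b : ℕ) (hab : b ≤ a) (c' u : ℝ) (hden : 1 - u ^ K ≠ 0)
    (hT : ∑ j ∈ range K, u ^ j ≠ 0) :
    c' * (u ^ b - u ^ a) / (1 - u ^ K) =
      c' * u ^ b * (∑ i ∈ range (a - b), u ^ i) / ∑ j ∈ range K, u ^ j := by
  have hua : u ^ a = u ^ b * u ^ (a - b) := by rw [← pow_add, Nat.add_sub_cancel' hab]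
  have hS : (∑ i ∈ range (a - b), u ^ i) * (1 - u) = 1 - u ^ (a - b) := geom_sum_mul_neg u (a - b)
  have hTK : (∑ j ∈ range K, u ^ j) * (1 - u) = 1 - u ^ K := geom_sum_mul_neg u K
  rw [div_eq_div_iff hden hT]
  linear_combination (-c' * ∑ j ∈ range K, u ^ j) * hua
    + (-c' * u ^ b * ∑ j ∈ range K, u ^ j) * hS + (c' * u ^ b * ∑ i ∈ range (a - b), u ^ i) * hTK

/-- **Stub (algebraic coefficient ⇒ `K`-rational slab):** the dimension-one representation
`[(0,1), (c/(a−b)) (u^b − u^a)/(1 − u^K)]` with `c` real algebraic has an integrand of the form `P/Q`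
with `P, Q ∈ K[X]`, `K = algebraicClosure ℚ ℝ`, and `Q` without zeros on `[0,1]`:
`P = C(c/(a−b)) X^b Σ_{i<a−b} X^i`, `Q = Σ_{j<K} X^j`, using
`(u^b − u^a)/(1 − u^K) = u^b (Σ_{i<a−b} u^i)/(Σ_{j<K} u^j)` for `b < a`, `0 < u < 1`, and
`Σ_{j<K} u^j ≥ 1` on `[0,1]` (`K ≥ 1`). [cite: KontsevichZagier2001, §1.1 Definition] -/
theorem levelK_dimOne_algSlab (K : ℕ) (hK : 0 < K) (a b : ℕ) (hab : b < a) (c : ℝ)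
    (hc : IsAlgebraic ℚ c) (N₁ : IntegralRep 1) (hN₁d : N₁.domain = {x | ∀ i, x i ∈ Set.Ioo (0:ℝ) 1})
    (hN₁i : EqOn N₁.integrand
      (fun x => c / ((a - b : ℕ) : ℝ) * (x 0 ^ b - x 0 ^ a) / (1 - x 0 ^ K)) N₁.domain) :
    ∃ P Q : (algebraicClosure ℚ ℝ)[X], (∀ t ∈ Set.Icc (0:ℝ) 1, (Polynomial.aeval t Q : ℝ) ≠ 0) ∧
      EqOn N₁.integrand (fun x => (Polynomial.aeval (x 0) P : ℝ) / Polynomial.aeval (x 0) Q)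
        N₁.domain := by
  have hcK : c / ((a - b : ℕ) : ℝ) ∈ algebraicClosure ℚ ℝ :=
    div_mem (mem_algebraicClosure_iff.mpr hc) (natCast_mem _ _)
  set c' : algebraicClosure ℚ ℝ := ⟨c / ((a - b : ℕ) : ℝ), hcK⟩ with hc'
  refine ⟨Polynomial.C c' * Polynomial.X ^ b * ∑ i ∈ range (a - b), Polynomial.X ^ i,
    ∑ j ∈ range K, Polynomial.X ^ j, fun t ht => ?_, fun x hx => ?_⟩
  · rw [lka_aeval_geom_sum]
    exact (lka_geom_sum_pos hK ht.1).ne'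
  · have hx' : x 0 ∈ Set.Ioo (0:ℝ) 1 := by rw [hN₁d] at hx; exact hx 0
    rw [hN₁i hx]
    simp only
    rw [map_mul, map_mul, map_pow, Polynomial.aeval_C, Polynomial.aeval_X, lka_aeval_geom_sum,
      lka_aeval_geom_sum, IntermediateField.algebraMap_apply]
    exact lka_cancel K a b hab.le _ (x 0) (sub_pos.2 (pow_lt_one₀ hx'.1.le hx'.2 hK.ne')).ne'
      (lka_geom_sum_pos hK hx'.1.le).ne'

end Summit.KontsevichZagierPeriods.HurwitzMicroSectors.NormalFormPrinciple.PiBox.LevelK
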